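import Summits.HodgeConjecture.HodgeConjecture.Theorems.HeckePrymWeilWeilTwelvefoldsSqrtMinus7AimedSplitProductSeven
import Summits.HodgeConjecture.HodgeConjecture.Theorems.HeckePrymWeilWeilTwelvefoldsSqrtMinus7HodgeRiemannLeaf
import HarnessLib

/-!
# The aiming lemma of the product trick for `K = ℚ(√-7)` (`d = 7`, every half-dimension `n ≥ 1`) — UNCONDITIONAL

Crux `WeilTwelvefoldsSqrtMinus7` (stmt-HodgeConjecture-1261), line `amnesic-secant-sheaves-split-fourteenfolds`
(lead seat c1), registered sub-goal `aimedSplitProduct_seven`: the instance `d = 7` (all `n ≥ 1`, `∃ B, ∀ A` shape) of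
the Literature named fact `Motives.exists_cmWeilSurface_aimedSplitProduct_of_ne_one_of_ne_three` (Markman
arXiv:2509.23403 §11.5 Step 2; van Geemen, LNM 1594, Lemma 5.2 (3), 5.3, 5.4; Schoen 1998 §10) is a THEOREM of the
tree: `aimedSplitProduct_seven_of_hodgeRiemann` (partner half + aiming half, this line) fed with Hodge–Riemann in
degree one, now PROVED in the tree (`Literature.AlgebraicGeometry.HodgeTheory.hodgeRiemann_degreeOne`, through the
line's closed leaf `stub_hodgeRiemannDegreeOne`).
-/

noncomputable section

set_option linter.dupNamespace false

open CategoryTheory Complex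
open Literature.AlgebraicGeometry Literature.AlgebraicGeometry.Motives
  Literature.AlgebraicGeometry.HodgeTheory Literature.AlgebraicTopology.SingularHomology

namespace Summit.HodgeConjecture.HodgeConjecture.Theorems.WeilTwelvefoldsSqrtMinus7.AmnesicSecantSheaves

/-- **The aiming lemma for `K = ℚ(√-7)` in every dimension `2n ≥ 2`, unconditionally**: one CM Weil surface
`(B, ψ)` — `B = E × E`, `E = ℂ/(ℤ + ℤ√-7)`, `ψ = ([√-7], -[√-7])`, `dim B = 2`, `ψ ≫ ψ = -7` — with a descent pair
`(b₊, b₋, η)`, such that for every complex abelian `2n`-fold `(A, φ)`, `n ≥ 1`, `φ ≫ φ = -7`, carrying a non-zero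
rational `(n,n)` Weil class, some projective embedding `e` of `A × B` and non-zero rational `a` make `(A × B, φ × ψ)` of
hyperbolic Weil type in half-dimension `n + 1` for the `K`-symmetrised hyperplane class `7·e^*a + (φ × ψ)^*e^*a`.
[cite: Markman2025SurveySecant, §11.5 Step 2] [cite: vanGeemen1994HodgeAV, Lemma 5.2 (3), 5.3 and 5.4 (5.4.1)]
[cite: Schoen1998HodgeWeilAddendum, §10] [cite: VoisinHodgeI2002, Thm. 6.32] -/
theorem aimedSplitProduct_seven :
    ∃ (B : AbelianVariety ℂ) (ψ : B ⟶ B), B.dim = 2 ∧ ψ ≫ ψ = -((7 : ℤ) • 𝟙 B) ∧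
      (∃ bp bm η : complexBetti B.X 2,
        bp ∈ Module.End.eigenspace (complexBetti.map (𝟙 B + ψ).hom.hom.hom 2).hom
              ((1 + Complex.I * (Real.sqrt (7 : ℝ) : ℂ)) ^ 2) ∧
        bm ∈ Module.End.eigenspace (complexBetti.map (𝟙 B + ψ).hom.hom.hom 2).hom
              ((1 - Complex.I * (Real.sqrt (7 : ℝ) : ℂ)) ^ 2) ∧
        IsRationalClass (bp + bm) ∧ IsOfHodgeType 2 B.X 2 1 1 (bp + bm) ∧
        η ∈ algebraicClasses B.X 1 ∧
        cupProduct (show 2 + 2 = 4 from rfl) bp η ≠ 0 ∧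
        cupProduct (show 2 + 2 = 4 from rfl) bm η ≠ 0) ∧
      ∀ (n : ℕ) (A : AbelianVariety ℂ) (φ : A ⟶ A), 1 ≤ n → A.dim = 2 * n →
        φ ≫ φ = -((7 : ℤ) • 𝟙 A) →
        (∃ c : complexBetti A.X (2 * n), c ≠ 0 ∧ IsRationalClass c ∧
          IsOfHodgeType (2 * n) A.X (2 * n) n n c ∧
          c ∈ Module.End.eigenspace (complexBetti.map (𝟙 A + φ).hom.hom.hom (2 * n)).hom
                ((1 + Complex.I * (Real.sqrt (7 : ℝ) : ℂ)) ^ (2 * n)) ⊔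
              Module.End.eigenspace (complexBetti.map (𝟙 A + φ).hom.hom.hom (2 * n)).hom
                ((1 - Complex.I * (Real.sqrt (7 : ℝ) : ℂ)) ^ (2 * n))) →
        ∃ (e : ProjectiveEmbedding (A.prod B).X) (a : complexBetti (projectiveSpace e.n ℂ) 2),
          IsRationalClass a ∧ a ≠ 0 ∧
          IsHyperbolicWeilType (A.prod B)
            (AbelianVariety.prodLift (AbelianVariety.fst A B ≫ φ) (AbelianVariety.snd A B ≫ ψ)) (n + 1)
            ((7 : ℂ) • complexBetti.map e.ι 2 a +
              complexBetti.map (AbelianVariety.prodLift (AbelianVariety.fst A B ≫ φ)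
                (AbelianVariety.snd A B ≫ ψ)).hom.hom.hom 2 (complexBetti.map e.ι 2 a)) :=
  aimedSplitProduct_seven_of_hodgeRiemann stub_hodgeRiemannDegreeOne

end Summit.HodgeConjecture.HodgeConjecture.Theorems.WeilTwelvefoldsSqrtMinus7.AmnesicSecantSheaves

end
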